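import Summits.Ventures.PercRepro.ProfilePointedCircuitClassesInOutReduce

/-!
# PercRepro — THE IN–OUT INEQUALITY AT THE BOTTOM OF NULLITY 4 HOLDS AT EVERY POINT IN NO SHORT CIRCUIT, AND THE
TWO-STEP COMPARISON `P_3 ≤ P_5` ON EVERY NULLITY-3 MATROID (p5, gen 38; `proofs/P5-GM1.md` §54)

Read through the deletion `M := N ∖ e` (nullity `3`, `n − 1` points, rank `ρ`): the bi-independent `4`-sets of `N`
through `e` inject into `BI_3(M)` (`W ↦ W − e`), and every `X ∈ BI_5(M)` is a bi-independent `5`-set of `N` avoiding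
`e` as soon as `e ∉ cl_N(E − e − X)`.  So `in_4(e) ≤ P_3(M)` and, when `e` lies in the closure of no independent
`(ρ − 2)`-subset of `E − e` (equivalently: no circuit of `N` through `e` has `≤ ρ − 1` elements — in particular the
free extension), `out_5(e) ≥ P_5(M) = P_{n−6}(M)`; the claim is then the comparison `P_3(M) ≤ P_5(M)` between the bottom
level and the level `n − 6` of a nullity-3 profile, which is NOT a bottom-level step: for `ρ = 6` it is `P_3 ≤ P_4`
(the kernel's `biIndep_step_three_of_nullity_three`), for `ρ ≥ 7` it follows from that step and a new weak step
`(ρ − 4)·P_4 ≤ 5·P_5` at the level `4` of nullity `3`, proved by the containment double counting: every `W ∈ BI_4`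
has at least `ρ − 4` extensions `W + a ∈ BI_5` because AT MOST THREE points of `E − W` lie in the rank-4 flat
`cl(W)` (four of them would span `W`, and then any further point `x` of `E − W` would satisfy `ρ(E − x) ≤ ρ − 2`),
and every `V ∈ BI_5` has at most `5` subsets in `BI_4`.

* `card_filter_mem_clF_le_three_of_biIndep_four` (the three-point lemma), **`biIndep_weak_step_four_of_nullity_three`**
  (`(ρ − 4)·P_4 ≤ 5·P_5` on `#E = ρ + 3`, `ρ ≥ 6`), **`biIndep_three_le_of_nullity_three`** (`P_3 ≤ P_{n−5}` on
  `#E = ρ + 3`, `ρ ≥ 6`), `inCount_four_le_card_biIndepSets_three_delete`,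
  `card_biIndepSets_five_delete_le_outCount_five_of_free`, **`inCount_four_le_outCount_five_of_free`**.
-/

open scoped Matroid

namespace PercRepro.Cogirth

open Finset ThmH Skew Shadow Profile

variable {α : Type} [DecidableEq α]

section InOutFree

variable {M : Matroid α} [M.Finite]

/-- A point of a set lies in its closure (`insert x X = X`). -/
theorem mem_clF_of_mem_of_subset_gr {X : Finset α} (hX : X ⊆ gr M) {x : α} (hx : x ∈ X) : x ∈ clF M X := by
  rw [mem_clF_iff_rk_insert_eq (hX hx) hX, insert_eq_of_mem hx]

/-- **THE THREE-POINT LEMMA** (nullity `3`, level `4`): for a bi-independent `4`-set `W` of a matroid with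
`#E = ρ(E) + 3`, `ρ(E) ≥ 6`, at most three points of `E ∖ W` lie in `cl(W)`.  Four such points `A` would have
`cl(A) = cl(W)` (both of rank `4`, `A ⊆ cl(W)`), so `W ⊆ cl(A)`, and then a fifth point `x` of `E ∖ W` would give
`ρ(E − x) ≤ ρ((E ∖ W) − x) ≤ #(E ∖ W) − 1 = ρ(E) − 2 < ρ(E) − 1 ≤ ρ(E − x)`. -/
theorem card_filter_mem_clF_le_three_of_biIndep_four (hn : (gr M).card = rk M (gr M) + 3)
    (hR : 6 ≤ rk M (gr M)) {W : Finset α} (hW : W ∈ biIndepSets M 4) :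
    ((gr M \ W).filter (fun a => a ∈ clF M W)).card ≤ 3 := by
  rw [mem_biIndepSets] at hW
  obtain ⟨hWg, hW4, hWrk, hWc⟩ := hW
  by_contra hcon
  have h4 : 4 ≤ ((gr M \ W).filter (fun a => a ∈ clF M W)).card := by omega
  obtain ⟨A, hAsub, hA4⟩ := exists_subset_card_eq h4
  have hAW : A ⊆ gr M \ W := hAsub.trans (filter_subset _ _)
  have hAcl : A ⊆ clF M W := fun a ha => (mem_filter.1 (hAsub ha)).2
  have hAg : A ⊆ gr M := hAW.trans sdiff_subset
  -- `A` is independent of rank `4`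
  have hArk : rk M A = 4 := by
    have := rk_eq_card_of_subset_of_rk_eq_card hAW hWc
    rwa [hA4] at this
  -- `W ∪ A ⊆ cl(W)`, so `rk (W ∪ A) = 4`
  have hWA : rk M (W ∪ A) = 4 := by
    have h1 : W ∪ A ⊆ clF M W := union_subset (fun w hw => mem_clF_of_mem_of_subset_gr hWg hw) hAcl
    have h2 := rk_le_rk_of_subset_finset (M := M) h1
    rw [rk_clF_eq_rk, hWrk] at h2
    have h3 := rk_le_rk_of_subset_finset (M := M) (subset_union_left (s₁ := W) (s₂ := A))
    rw [hWrk] at h3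
    omega
  -- hence `W ⊆ cl(A)`
  have hWclA : W ⊆ clF M A := by
    intro w hw
    rw [mem_clF_iff_rk_insert_eq (hWg hw) hAg]
    have h1 := rk_le_rk_of_subset_finset (M := M) (insert_subset (mem_union_left A hw) (subset_union_right (s₁ := W) (s₂ := A)))
    have h2 := rk_le_rk_of_subset_finset (M := M) (subset_insert w A)
    omega
  -- a fifth point `x ∈ (E ∖ W) ∖ A`
  have hcardWc : (gr M \ W).card = rk M (gr M) - 1 := by
    rw [card_sdiff_of_subset hWg, hW4]
    omega
  obtain ⟨x, hxWc, hxA⟩ := exists_mem_notMem_of_card_lt_card (show A.card < (gr M \ W).card by omega)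
  have hxg : x ∈ gr M := (mem_sdiff.1 hxWc).1
  have hxW : x ∉ W := (mem_sdiff.1 hxWc).2
  -- `(E ∖ W) − x` spans `E − x`
  have hsub : (gr M).erase x ⊆ clF M ((gr M \ W).erase x) := by
    intro y hy
    rw [mem_erase] at hy
    by_cases hyW : y ∈ W
    · have hA' : A ⊆ (gr M \ W).erase x := by
        intro a ha
        rw [mem_erase]
        exact ⟨fun h => hxA (h ▸ ha), hAW ha⟩
      exact mem_clF_of_subset hA' (hWclA hyW)
    · exact mem_clF_of_mem_of_subset_gr ((erase_subset _ _).trans sdiff_subset) (mem_erase.2 ⟨hy.1, mem_sdiff.2 ⟨hy.2, hyW⟩⟩)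
  have h1 := rk_le_rk_of_subset_finset (M := M) hsub
  rw [rk_clF_eq_rk] at h1
  have h2 := rk_le_card (M := M) ((gr M \ W).erase x)
  rw [card_erase_of_mem hxWc, hcardWc] at h2
  have h3 := rk_le_rk_erase_add_one (M := M) (Subset.refl (gr M)) hxg
  omega

/-- **THE WEAK STEP AT THE LEVEL `4` OF NULLITY `3`**: on `#E = ρ(E) + 3`, `ρ(E) ≥ 6`, `(ρ − 4)·P_4 ≤ 5·P_5`.
Every `W ∈ BI_4` has at least `ρ − 4` extensions `W + a ∈ BI_5` (the points `a ∈ E ∖ W` off `cl(W)`, by the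
three-point lemma), every `V ∈ BI_5` has at most `5` subsets in `BI_4`. -/
theorem biIndep_weak_step_four_of_nullity_three (hn : (gr M).card = rk M (gr M) + 3)
    (hR : 6 ≤ rk M (gr M)) :
    (rk M (gr M) - 4) * (biIndepSets M 4).card ≤ 5 * (biIndepSets M 5).card := by
  set D := biIndepSets M 4 with hD
  set U := biIndepSets M 5 with hU
  have hdeg : ∀ W ∈ D, rk M (gr M) - 4 ≤ (U.filter (fun V => W ⊆ V)).card := by
    intro W hW
    have hW' := hW
    rw [hD, mem_biIndepSets] at hW'
    obtain ⟨hWg, hW4, hWrk, hWc⟩ := hW'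
    have hthree := card_filter_mem_clF_le_three_of_biIndep_four hn hR hW
    have hsplit := card_filter_add_card_filter_not (s := gr M \ W) (p := fun a => a ∈ clF M W)
    have hcardWc : (gr M \ W).card = rk M (gr M) - 1 := by
      rw [card_sdiff_of_subset hWg, hW4]
      omega
    have hmaps : ∀ a ∈ (gr M \ W).filter (fun a => a ∉ clF M W), insert a W ∈ U.filter (fun V => W ⊆ V) := by
      intro a ha
      rw [mem_filter, mem_sdiff] at ha
      obtain ⟨⟨hag, haW⟩, hacl⟩ := ha
      rw [mem_filter, hU, mem_biIndepSets]
      refine ⟨⟨insert_subset hag hWg, ?_, ?_, ?_⟩, subset_insert a W⟩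
      · rw [card_insert_of_notMem haW, hW4]
      · rw [rk_insert_eq hag hWg, if_neg hacl, hWrk, card_insert_of_notMem haW, hW4]
      · rw [sdiff_insert]
        exact rk_eq_card_of_subset_of_rk_eq_card (erase_subset _ _) hWc
    have hinj : Set.InjOn (fun a => insert a W) ((gr M \ W).filter (fun a => a ∉ clF M W) : Finset α) := by
      intro a ha b hb hab
      rw [mem_coe, mem_filter, mem_sdiff] at ha hb
      simp only at hab
      have : a ∈ insert b W := hab ▸ mem_insert_self a W
      rw [mem_insert] at this
      rcases this with h | h
      · exact h
      · exact absurd h ha.1.2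
    calc rk M (gr M) - 4 ≤ ((gr M \ W).filter (fun a => a ∉ clF M W)).card := by omega
      _ ≤ (U.filter (fun V => W ⊆ V)).card := card_le_card_of_injOn _ hmaps hinj
  have hco : ∀ V ∈ U, (D.filter (fun W => W ⊆ V)).card ≤ 5 := by
    intro V hV
    rw [hU, mem_biIndepSets] at hV
    obtain ⟨hVg, hV5, hVrk, hVc⟩ := hV
    have hsub : D.filter (fun W => W ⊆ V) ⊆ V.image (fun a => V.erase a) := by
      intro W hW
      rw [mem_filter] at hW
      obtain ⟨hWD, hWV⟩ := hW
      rw [hD, mem_biIndepSets] at hWD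
      obtain ⟨_, hW4, _, _⟩ := hWD
      obtain ⟨a, haV, haW⟩ := exists_mem_notMem_of_card_lt_card (show W.card < V.card by omega)
      rw [mem_image]
      refine ⟨a, haV, ?_⟩
      have hWe : W = V.erase a := by
        apply eq_of_subset_of_card_le
        · intro w hw
          rw [mem_erase]
          exact ⟨fun h => haW (h ▸ hw), hWV hw⟩
        · rw [card_erase_of_mem haV, hV5, hW4]
      exact hWe.symm
    calc (D.filter (fun W => W ⊆ V)).card ≤ (V.image (fun a => V.erase a)).card := card_le_card hsub
      _ ≤ V.card := card_image_le
      _ = 5 := hV5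
  have h := sum_card_bipartiteAbove_eq_sum_card_bipartiteBelow (r := fun (W V : Finset α) => W ⊆ V) (s := D) (t := U)
  simp only [bipartiteAbove, bipartiteBelow] at h
  have h1 : D.card * (rk M (gr M) - 4) ≤ ∑ W ∈ D, (U.filter (fun V => W ⊆ V)).card := by
    rw [← smul_eq_mul]
    exact card_nsmul_le_sum _ _ _ hdeg
  have h2 : ∑ V ∈ U, (D.filter (fun W => W ⊆ V)).card ≤ U.card * 5 := by
    rw [← smul_eq_mul]
    exact sum_le_card_nsmul _ _ _ hco
  have h3 : D.card * (rk M (gr M) - 4) ≤ U.card * 5 := by omega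
  rw [mul_comm, mul_comm 5]
  exact h3

/-- **THE TWO-STEP COMPARISON `P_3 ≤ P_{n−5}` AT NULLITY `3`**: on `#E = ρ(E) + 3`, `ρ(E) ≥ 6`, the bi-independent
`3`-sets are at most the bi-independent `(n − 5)`-sets (`= P_5` by complementation).  For `ρ = 6` this is `P_3 ≤ P_4`
(the kernel's bottom step); for `ρ ≥ 7` the bottom step `ρ·P_3 ≤ 4·P_4` and the weak step `(ρ − 4)·P_4 ≤ 5·P_5` give
`ρ(ρ − 4)·P_3 ≤ 20·P_5` with `ρ(ρ − 4) ≥ 21`. -/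
theorem biIndep_three_le_of_nullity_three (hn : (gr M).card = rk M (gr M) + 3) (hR : 6 ≤ rk M (gr M)) :
    (biIndepSets M 3).card ≤ (biIndepSets M ((gr M).card - 5)).card := by
  have hstep := biIndep_step_three_of_nullity_three hn (by omega)
  have hsym5 := card_biIndepSets_symm M (k := 5) (by omega)
  rw [← hsym5]
  rcases Nat.lt_or_ge (rk M (gr M)) 7 with h6 | h7
  · have hsym4 := card_biIndepSets_symm M (k := 4) (by omega)
    have e1 : (gr M).card - 4 = 5 := by omega
    rw [e1] at hsym4
    rw [← hsym4]
    have e2 : (gr M).card - 3 = 6 := by omega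
    rw [e2] at hstep
    omega
  · have hw := biIndep_weak_step_four_of_nullity_three hn hR
    have e3 : (gr M).card - 3 = rk M (gr M) := by omega
    rw [e3] at hstep
    have h3 : 21 ≤ (rk M (gr M) - 4) * rk M (gr M) :=
      (show (21 : ℕ) = 3 * 7 by norm_num) ▸ Nat.mul_le_mul (by omega) h7
    have h4 : 21 * (biIndepSets M 3).card ≤ (rk M (gr M) - 4) * rk M (gr M) * (biIndepSets M 3).card :=
      Nat.mul_le_mul_right _ h3
    have h5 : (rk M (gr M) - 4) * rk M (gr M) * (biIndepSets M 3).card ≤ 20 * (biIndepSets M 5).card := by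
      calc (rk M (gr M) - 4) * rk M (gr M) * (biIndepSets M 3).card
          = (rk M (gr M) - 4) * (rk M (gr M) * (biIndepSets M 3).card) := by ring
        _ ≤ (rk M (gr M) - 4) * (4 * (biIndepSets M 4).card) := Nat.mul_le_mul_left _ hstep
        _ = 4 * ((rk M (gr M) - 4) * (biIndepSets M 4).card) := by ring
        _ ≤ 4 * (5 * (biIndepSets M 5).card) := Nat.mul_le_mul_left _ hw
        _ = 20 * (biIndepSets M 5).card := by ring
    omega

end InOutFree

section InOutFreeN

variable {N : Matroid α} [N.Finite]

/-- `in_4(e) ≤ P_3(N ∖ e)`: `W ↦ W − e` is an injection of the bi-independent `4`-sets of `N` through `e` into the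
bi-independent `3`-sets of the deletion. -/
theorem inCount_four_le_card_biIndepSets_three_delete (e : α) :
    inCount N 4 e ≤ (biIndepSets (N ＼ ({e} : Set α)) 3).card := by
  unfold inCount
  apply card_le_card_of_injOn (fun W => W.erase e)
  · intro W hW
    rw [mem_coe, mem_filter, mem_biIndepSets] at hW
    obtain ⟨⟨hWg, hW4, hWrk, hWc⟩, heW⟩ := hW
    show W.erase e ∈ biIndepSets (N ＼ ({e} : Set α)) 3
    rw [mem_biIndepSets, gr_delete']
    have hWe : W.erase e ⊆ (gr N).erase e := erase_subset_erase e hWg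
    have hWe' : W.erase e ⊆ gr N := hWe.trans (erase_subset _ _)
    have heWe : e ∉ W.erase e := fun h => (mem_erase.1 h).1 rfl
    refine ⟨hWe, ?_, ?_, ?_⟩
    · rw [card_erase_of_mem heW, hW4]
    · rw [rk_delete hWe]
      exact rk_eq_card_of_subset_of_rk_eq_card (erase_subset _ _) hWrk
    · have e1 : (gr N).erase e \ W.erase e = gr N \ W := by
        ext a
        simp only [mem_sdiff, mem_erase]
        constructor
        · rintro ⟨⟨hae, hag⟩, h⟩
          exact ⟨hag, fun haW => h ⟨hae, haW⟩⟩
        · rintro ⟨hag, haW⟩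
          exact ⟨⟨fun h => haW (h ▸ heW), hag⟩, fun h => haW h.2⟩
      have hWc' : gr N \ W ⊆ (gr N).erase e :=
        fun a ha => mem_erase.2 ⟨fun h => (mem_sdiff.1 ha).2 (h ▸ heW), (mem_sdiff.1 ha).1⟩
      rw [e1, rk_delete hWc']
      exact hWc
  · intro W hW W' hW' h
    rw [mem_coe, mem_filter] at hW hW'
    simp only at h
    rw [← insert_erase hW.2, ← insert_erase hW'.2, h]

/-- Every `X ∈ BI_5(N ∖ e)` is a bi-independent `5`-set of `N` avoiding `e` as soon as `e ∉ cl_N(E − e − X)`; so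
when `e` lies in the closure of no independent `(ρ − 2)`-subset of `E − e`, `P_5(N ∖ e) ≤ out_5(e)`. -/
theorem card_biIndepSets_five_delete_le_outCount_five_of_free {e : α} (he : e ∈ gr N)
    (hfree : ∀ X ⊆ (gr N).erase e, X.card + 2 = rk N (gr N) → rk N X = X.card → e ∉ clF N X)
    (hn : (gr N).card = rk N (gr N) + 4) :
    (biIndepSets (N ＼ ({e} : Set α)) 5).card ≤ outCount N 5 e := by
  unfold outCount
  apply card_le_card_of_injOn (fun X => X)
  · intro X hX
    rw [mem_coe, mem_biIndepSets, gr_delete'] at hX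
    obtain ⟨hXg, hX5, hXrk, hXc⟩ := hX
    have hXg' : X ⊆ gr N := hXg.trans (erase_subset _ _)
    have heX : e ∉ X := fun h => (mem_erase.1 (hXg h)).1 rfl
    rw [rk_delete hXg] at hXrk
    have hY : (gr N).erase e \ X ⊆ (gr N).erase e := sdiff_subset
    have hY' : (gr N).erase e \ X ⊆ gr N := hY.trans (erase_subset _ _)
    have heY : e ∉ (gr N).erase e \ X := fun h => (mem_erase.1 (mem_sdiff.1 h).1).1 rfl
    rw [rk_delete hY] at hXc
    have h5 : 5 ≤ ((gr N).erase e).card := by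
      rw [← hX5]
      exact card_le_card hXg
    have hYcard : ((gr N).erase e \ X).card + 2 = rk N (gr N) := by
      rw [card_sdiff_of_subset hXg, card_erase_of_mem he, hX5]
      rw [card_erase_of_mem he] at h5
      omega
    have hecl := hfree _ hY hYcard hXc
    show X ∈ (biIndepSets N 5).filter (fun X => e ∉ X)
    rw [mem_filter, mem_biIndepSets]
    refine ⟨⟨hXg', hX5, hXrk, ?_⟩, heX⟩
    have e1 : gr N \ X = insert e ((gr N).erase e \ X) := by
      ext a
      simp only [mem_sdiff, mem_insert, mem_erase]
      constructor
      · rintro ⟨hag, haX⟩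
        by_cases hae : a = e
        · exact Or.inl hae
        · exact Or.inr ⟨⟨hae, hag⟩, haX⟩
      · rintro (rfl | ⟨⟨_, hag⟩, haX⟩)
        · exact ⟨he, heX⟩
        · exact ⟨hag, haX⟩
    rw [e1, rk_insert_eq he hY', if_neg hecl, hXc, card_insert_of_notMem heY]
  · intro X _ X' _ h
    exact h

/-- **`InOutBottomFour` HOLDS AT EVERY POINT IN NO SHORT CIRCUIT**: on `#E = ρ(E) + 4`, `ρ(E) ≥ 6`, a non-coloop
`e` that lies in the closure of no independent `(ρ − 2)`-subset of `E − e` — equivalently, no circuit of `N` through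
`e` has at most `ρ − 1` elements (the free extension of `N ∖ e` is the extreme case) — satisfies `in_4(e) ≤ out_5(e)`:
`in_4(e) ≤ P_3(N ∖ e) ≤ P_{n−6}(N ∖ e) = P_5(N ∖ e) ≤ out_5(e)` by `biIndep_three_le_of_nullity_three` on the
nullity-3 deletion. -/
theorem inCount_four_le_outCount_five_of_free (hn : (gr N).card = rk N (gr N) + 4) (hR : 6 ≤ rk N (gr N))
    {e : α} (he : e ∈ gr N) (hnc : rk N ((gr N).erase e) = rk N (gr N))
    (hfree : ∀ X ⊆ (gr N).erase e, X.card + 2 = rk N (gr N) → rk N X = X.card → e ∉ clF N X) :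
    inCount N 4 e ≤ outCount N 5 e := by
  have h1 := inCount_four_le_card_biIndepSets_three_delete (N := N) e
  have h2 := card_biIndepSets_five_delete_le_outCount_five_of_free he hfree hn
  have hgr : gr (N ＼ ({e} : Set α)) = (gr N).erase e := gr_delete'
  have hrkM : rk (N ＼ ({e} : Set α)) ((gr N).erase e) = rk N (gr N) := by
    rw [rk_delete (M := N) (e := e) (Subset.refl ((gr N).erase e))]
    exact hnc
  have hnM : (gr (N ＼ ({e} : Set α))).card = rk (N ＼ ({e} : Set α)) (gr (N ＼ ({e} : Set α))) + 3 := by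
    rw [hgr, hrkM, card_erase_of_mem he]
    omega
  have hRM : 6 ≤ rk (N ＼ ({e} : Set α)) (gr (N ＼ ({e} : Set α))) := by
    rw [hgr, hrkM]
    exact hR
  have hsym := card_biIndepSets_symm (N ＼ ({e} : Set α)) (k := 5) (by rw [hgr, card_erase_of_mem he]; omega)
  have h3 := biIndep_three_le_of_nullity_three hnM hRM
  rw [hgr, card_erase_of_mem he] at h3 hsym
  rw [← hsym] at h3
  omega

end InOutFreeN

end PercRepro.Cogirth
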